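import Literature.RingTheory.MvPolynomial.HilbertPolynomialDegree
import Mathlib.Algebra.MvPolynomial.PDeriv
import Mathlib.Algebra.MvPolynomial.Funext
import Mathlib.Algebra.Polynomial.BigOperators
import Mathlib.Algebra.Polynomial.Degree.SmallDegree
import HarnessLib

/-!
# Comparing total degrees from eventual inequalities, and iterated directional derivatives of
# monomials

Topic: `Literature/RingTheory/MvPolynomial`. Two book-keeping results about polynomials
`P ∈ ℚ[T_l : l ∈ ι]` for the multigraded Bézout count:

* **`totalDegree_le_of_eventually_le`** — if `0 ≤ P(t) ≤ P'(t)` at all lattice points `t ≥ t₀`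
  then `deg P ≤ deg P'` (restrict to a line `t₀ + s·w` on which the top form of `P` does not
  vanish, `polynomial_eval_lineRestrict`, `coeff_lineRestrict_totalDegree`, and use that a
  non-zero rational polynomial eventually `≥ 0` on `ℕ` has positive leading coefficient,
  `leadingCoeff_pos_of_eventually_nonneg`);
* **`iterDirDeriv_monomial`** — for a word `δ_1, …, δ_r` of directions and an exponent `c` with
  `|c| = r`, `(L_{δ_r} ∘ ⋯ ∘ L_{δ_1})(T^c) = c! · [T^c] Π_j (Σ_l δ_{j,l} T_l)`, where
  `L_δ = Σ_l δ_l ∂_l`: iterated directional derivatives of a monomial compute mixed Bézout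
  numbers.

## References

* B. L. van der Waerden, *On Hilbert's function, series of composition of ideals and a
  generalization of the theorem of Bézout*, Proc. Royal Acad. Amsterdam 31 (1928), 749–770.
-/

noncomputable section

open MvPolynomial Finset

namespace Literature.RingTheory.MvPolynomial

variable {ι : Type*} [Fintype ι] [DecidableEq ι]

/-! ## Restriction of a polynomial to a line `t₀ + s·w` -/

omit [Fintype ι] [DecidableEq ι] in
/-- **The restriction of `P` to the line `s ↦ t₀ + s w`**, the univariate polynomial obtained by
`X_l ↦ t₀_l + w_l·s`, evaluates as expected. [folklore] -/
theorem polynomial_eval_lineRestrict (t₀ w : ι → ℚ) (P : MvPolynomial ι ℚ) (s : ℚ) :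
    Polynomial.eval s (MvPolynomial.eval₂Hom Polynomial.C
        (fun l : ι => Polynomial.C (w l) * Polynomial.X + Polynomial.C (t₀ l)) P) =
      MvPolynomial.eval (fun l => t₀ l + s * w l) P := by
  induction P using MvPolynomial.induction_on with
  | C a => simp
  | add p q hp hq => simp only [map_add, Polynomial.eval_add, hp, hq]
  | mul_X p i hp =>
    simp only [map_mul, Polynomial.eval_mul, hp, MvPolynomial.eval₂Hom_X', MvPolynomial.eval_X,
      Polynomial.eval_add, Polynomial.eval_C, Polynomial.eval_mul, Polynomial.eval_X]
    ring

omit [DecidableEq ι] in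
/-- The restriction of the monomial `T^c` to a line with all `w_l ≠ 0` has degree `|c|` and
leading coefficient `Π_l w_l^{c_l}`. [folklore] -/
theorem natDegree_leadingCoeff_lineRestrict_monomial (t₀ w : ι → ℚ) (hw : ∀ l, w l ≠ 0)
    (c : ι →₀ ℕ) :
    (MvPolynomial.eval₂Hom Polynomial.C
        (fun l : ι => Polynomial.C (w l) * Polynomial.X + Polynomial.C (t₀ l))
          (monomial c (1 : ℚ))).natDegree = c.degree ∧
    (MvPolynomial.eval₂Hom Polynomial.C
        (fun l : ι => Polynomial.C (w l) * Polynomial.X + Polynomial.C (t₀ l))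
          (monomial c (1 : ℚ))).leadingCoeff = ∏ l, w l ^ c l := by
  classical
  have hdeg : ∀ l, (Polynomial.C (w l) * Polynomial.X + Polynomial.C (t₀ l)).natDegree = 1 :=
    fun l => Polynomial.natDegree_linear (hw l)
  have hlc : ∀ l, (Polynomial.C (w l) * Polynomial.X + Polynomial.C (t₀ l)).leadingCoeff = w l :=
    fun l => Polynomial.leadingCoeff_linear (hw l)
  have hpowlc : ∀ l (k : ℕ),
      ((Polynomial.C (w l) * Polynomial.X + Polynomial.C (t₀ l)) ^ k).leadingCoeff = w l ^ k := by
    intro l k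
    rw [Polynomial.leadingCoeff_pow' (by rw [hlc]; exact pow_ne_zero _ (hw l)), hlc]
  have hpowdeg : ∀ l (k : ℕ),
      ((Polynomial.C (w l) * Polynomial.X + Polynomial.C (t₀ l)) ^ k).natDegree = k := by
    intro l k
    rw [Polynomial.natDegree_pow' (by rw [hlc]; exact pow_ne_zero _ (hw l)), hdeg, mul_one]
  rw [MvPolynomial.eval₂Hom_monomial, Polynomial.C_1, one_mul, Finsupp.prod]
  have hne : (∏ l ∈ c.support,
      ((Polynomial.C (w l) * Polynomial.X + Polynomial.C (t₀ l)) ^ c l).leadingCoeff) ≠ 0 := by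
    rw [Finset.prod_ne_zero_iff]
    intro l _
    rw [hpowlc]
    exact pow_ne_zero _ (hw l)
  constructor
  · rw [Polynomial.natDegree_prod' _ _ hne]
    simp_rw [hpowdeg]
    rfl
  · rw [Polynomial.leadingCoeff_prod' _ _ hne]
    simp_rw [hpowlc]
    exact Finset.prod_subset (Finset.subset_univ _) fun l _ hl => by
      rw [Finsupp.notMem_support_iff.mp hl, pow_zero]

omit [DecidableEq ι] in
/-- **The coefficient of `s^{deg P}` in the restriction of `P` to the line `t₀ + s w` is the
value of the top form of `P` at `w`**, and the restriction has degree `≤ deg P`. [folklore] -/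
theorem coeff_lineRestrict_totalDegree (t₀ w : ι → ℚ) (hw : ∀ l, w l ≠ 0) (P : MvPolynomial ι ℚ) :
    (MvPolynomial.eval₂Hom Polynomial.C
        (fun l : ι => Polynomial.C (w l) * Polynomial.X + Polynomial.C (t₀ l)) P).natDegree
        ≤ P.totalDegree ∧
    (MvPolynomial.eval₂Hom Polynomial.C
        (fun l : ι => Polynomial.C (w l) * Polynomial.X + Polynomial.C (t₀ l)) P).coeff
          P.totalDegree = MvPolynomial.eval w (homogeneousComponent P.totalDegree P) := by
  classical
  set ρ := MvPolynomial.eval₂Hom Polynomial.C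
    (fun l : ι => Polynomial.C (w l) * Polynomial.X + Polynomial.C (t₀ l)) with hρ
  have hexp : ρ P = ∑ c ∈ P.support, Polynomial.C (coeff c P) * ρ (monomial c 1) := by
    conv_lhs => rw [P.as_sum]
    rw [map_sum]
    refine Finset.sum_congr rfl fun c _ => ?_
    rw [show monomial c (coeff c P) = C (coeff c P) * monomial c 1 by
      rw [C_mul_monomial, mul_one], map_mul, hρ, MvPolynomial.eval₂Hom_C]
  have hmono := fun c => natDegree_leadingCoeff_lineRestrict_monomial t₀ w hw c
  constructor
  · rw [hexp]
    refine (Polynomial.natDegree_sum_le _ _).trans (Finset.sup_le fun c hc => ?_)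
    refine (Polynomial.natDegree_C_mul_le _ _).trans ?_
    change (ρ (monomial c 1)).natDegree ≤ P.totalDegree
    rw [(hmono c).1]
    exact le_totalDegree hc
  · rw [hexp, Polynomial.finsetSum_coeff, homogeneousComponent_apply, map_sum, Finset.sum_filter]
    refine Finset.sum_congr rfl fun c hc => ?_
    rw [Polynomial.coeff_C_mul]
    change coeff c P * (ρ (monomial c 1)).coeff P.totalDegree = _
    by_cases hcd : c.degree = P.totalDegree
    · rw [if_pos hcd, ← hcd, ← (hmono c).1, Polynomial.coeff_natDegree, (hmono c).2, eval_monomial,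
        Finsupp.prod_fintype _ _ (fun l => pow_zero _)]
    · rw [if_neg hcd, Polynomial.coeff_eq_zero_of_natDegree_lt, mul_zero]
      rw [(hmono c).1]
      exact lt_of_le_of_ne (le_totalDegree hc) hcd

/-! ## Total degrees from eventual inequalities -/

omit [Fintype ι] [DecidableEq ι] in
/-- The top form of a non-zero polynomial does not vanish. [folklore] -/
theorem homogeneousComponent_totalDegree_ne_zero {P : MvPolynomial ι ℚ} (hP : P ≠ 0) :
    homogeneousComponent P.totalDegree P ≠ 0 := by
  classical
  obtain ⟨c, hc, hcdeg⟩ : ∃ c ∈ P.support, (c.sum fun _ e => e) = P.totalDegree := by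
    obtain ⟨c, hc, hmax⟩ := Finset.exists_max_image P.support (fun c => c.sum fun _ e => e)
      (support_nonempty.mpr hP)
    exact ⟨c, hc, le_antisymm (le_totalDegree hc) (Finset.sup_le fun c' hc' => hmax c' hc')⟩
  intro h
  have hcdeg' : c.degree = P.totalDegree := hcdeg
  have := congr_arg (coeff c) h
  rw [coeff_homogeneousComponent, if_pos hcdeg', coeff_zero] at this
  exact (mem_support_iff.mp hc) this

omit [Fintype ι] [DecidableEq ι] in
/-- A non-zero rational polynomial does not vanish at every lattice point with positive
coordinates. [folklore] -/
theorem exists_pos_eval_ne_zero {F : MvPolynomial ι ℚ} (hF : F ≠ 0) :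
    ∃ w : ι → ℕ, (∀ l, 1 ≤ w l) ∧ MvPolynomial.eval (fun l => (w l : ℚ)) F ≠ 0 := by
  by_contra h
  push Not at h
  apply hF
  refine MvPolynomial.funext_set (fun _ => Set.range fun k : ℕ => ((k + 1 : ℕ) : ℚ))
    (fun _ => Set.infinite_range_of_injective fun k k' hkk' => by
      have : (k + 1 : ℕ) = k' + 1 := by exact_mod_cast hkk'
      omega) fun x hx => ?_
  rw [Set.mem_univ_pi] at hx
  choose k hk using hx
  have hxeq : x = fun l => ((k l + 1 : ℕ) : ℚ) := funext fun l => (hk l).symm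
  rw [hxeq, map_zero]
  exact h (fun l => k l + 1) fun l => Nat.le_add_left _ _

omit [DecidableEq ι] in
/-- **Total degrees compare along eventual pointwise inequalities**: if `0 ≤ P(t) ≤ P'(t)` for
all lattice points `t ≥ t₀`, then `deg P ≤ deg P'` (restrict to a line `t₀ + s·w` on which the
top form of `P` does not vanish and compare leading coefficients: a non-zero rational polynomial
which is eventually `≥ 0` on `ℕ` has positive leading coefficient). [folklore] -/
theorem totalDegree_le_of_eventually_le {P P' : MvPolynomial ι ℚ} (t₀ : ι → ℕ)
    (h : ∀ t : ι → ℕ, t₀ ≤ t → 0 ≤ MvPolynomial.eval (fun l => (t l : ℚ)) P ∧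
      MvPolynomial.eval (fun l => (t l : ℚ)) P ≤ MvPolynomial.eval (fun l => (t l : ℚ)) P') :
    P.totalDegree ≤ P'.totalDegree := by
  classical
  by_contra hlt
  push Not at hlt
  have hP0 : P ≠ 0 := fun h0 => by rw [h0, totalDegree_zero] at hlt; exact Nat.not_lt_zero _ hlt
  obtain ⟨w, hw1, hwF⟩ := exists_pos_eval_ne_zero (homogeneousComponent_totalDegree_ne_zero hP0)
  have hw : ∀ l, (w l : ℚ) ≠ 0 := fun l => by exact_mod_cast (Nat.one_le_iff_ne_zero.mp (hw1 l))
  -- restrictions to the line `t₀ + s w`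
  set ρ := MvPolynomial.eval₂Hom Polynomial.C
    (fun l : ι => Polynomial.C (w l : ℚ) * Polynomial.X + Polynomial.C (t₀ l : ℚ)) with hρ
  obtain ⟨hpdeg, hpcoeff⟩ := coeff_lineRestrict_totalDegree (fun l => (t₀ l : ℚ)) (fun l => (w l : ℚ)) hw P
  obtain ⟨hqdeg, -⟩ := coeff_lineRestrict_totalDegree (fun l => (t₀ l : ℚ)) (fun l => (w l : ℚ)) hw P'
  have hpnat : (ρ P).natDegree = P.totalDegree := by
    refine le_antisymm hpdeg (Polynomial.le_natDegree_of_ne_zero ?_)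
    change (ρ P).coeff P.totalDegree ≠ 0
    rw [hpcoeff]; exact hwF
  have hp0 : ρ P ≠ 0 := fun h0 => by
    have := hpcoeff
    rw [show (MvPolynomial.eval₂Hom Polynomial.C (fun l : ι => Polynomial.C (w l : ℚ) * Polynomial.X +
      Polynomial.C (t₀ l : ℚ))) P = ρ P from rfl, h0, Polynomial.coeff_zero] at this
    exact hwF this.symm
  have hplc : (ρ P).leadingCoeff = MvPolynomial.eval (fun l => (w l : ℚ)) (homogeneousComponent P.totalDegree P) := by
    rw [Polynomial.leadingCoeff, hpnat]; exact hpcoeff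
  -- values along the line
  have hval : ∀ (Q : MvPolynomial ι ℚ) (s : ℕ), (ρ Q).eval (s : ℚ) =
      MvPolynomial.eval (fun l => ((t₀ l + s * w l : ℕ) : ℚ)) Q := by
    intro Q s
    rw [hρ, polynomial_eval_lineRestrict]
    have hfun : (fun l => (t₀ l : ℚ) + (s : ℚ) * (w l : ℚ)) = fun l => ((t₀ l + s * w l : ℕ) : ℚ) := by
      funext l
      push_cast
      ring
    rw [hfun]
  have hle : ∀ s : ℕ, t₀ ≤ fun l => t₀ l + s * w l := fun s l => Nat.le_add_right _ _
  -- `ρ P` is eventually `≥ 0`, hence has positive leading coefficient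
  have hpos : 0 < (ρ P).leadingCoeff :=
    leadingCoeff_pos_of_eventually_nonneg hp0 (t₀ := 0) fun s _ => by
      rw [hval]; exact (h _ (hle s)).1
  -- `ρ P' - ρ P` is eventually `≥ 0`, of the same degree as `ρ P` with opposite leading coefficient
  have hqlt : (ρ P').natDegree < (ρ P).natDegree := by
    rw [hpnat]; exact lt_of_le_of_lt hqdeg hlt
  have hr0 : ρ P' - ρ P ≠ 0 := fun h0 => by
    have := congr_arg Polynomial.natDegree h0
    rw [Polynomial.natDegree_sub_eq_right_of_natDegree_lt hqlt, Polynomial.natDegree_zero] at this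
    rw [this] at hqlt
    exact Nat.not_lt_zero _ hqlt
  have hrpos : 0 < (ρ P' - ρ P).leadingCoeff :=
    leadingCoeff_pos_of_eventually_nonneg hr0 (t₀ := 0) fun s _ => by
      rw [Polynomial.eval_sub, hval, hval, sub_nonneg]; exact (h _ (hle s)).2
  have hrlc : (ρ P' - ρ P).leadingCoeff = -(ρ P).leadingCoeff := by
    rw [sub_eq_add_neg, Polynomial.leadingCoeff_add_of_degree_lt, Polynomial.leadingCoeff_neg]
    rw [Polynomial.degree_neg]
    exact Polynomial.degree_lt_degree hqlt
  rw [hrlc] at hrpos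
  linarith

/-! ## Iterated directional derivatives of monomials -/

/-- The coefficient recursion for products of linear forms:
`[T^c] (P · Σ_l δ_l T_l) = Σ_{l : c_l ≥ 1} δ_l [T^{c - e_l}] P`. [folklore] -/
theorem coeff_mul_linearForm (P : MvPolynomial ι ℚ) (δ : ι → ℕ) (c : ι →₀ ℕ) :
    coeff c (P * ∑ l, (δ l : ℚ) • X l) =
      ∑ l ∈ (univ : Finset ι).filter (fun l => 1 ≤ c l), (δ l : ℚ) * coeff (c - Finsupp.single l 1) P := by
  rw [Finset.mul_sum, coeff_sum, Finset.sum_filter]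
  refine Finset.sum_congr rfl fun l _ => ?_
  rw [mul_smul_comm, coeff_smul, coeff_mul_X', smul_eq_mul]
  by_cases hl : 1 ≤ c l
  · rw [if_pos hl, if_pos (Finsupp.mem_support_iff.mpr (by omega))]
  · rw [if_neg hl, if_neg (fun hmem => hl (Nat.one_le_iff_ne_zero.mpr (Finsupp.mem_support_iff.mp hmem))),
      mul_zero]

/-- **Iterated directional derivatives of a monomial compute mixed Bézout numbers**: for a word
of directions `δ_1, …, δ_r ∈ ℕ^ι` (a list `L`, applied head first) and an exponent `c` with
`|c| = r`, `(L_{δ_r} ∘ ⋯ ∘ L_{δ_1})(T^c) = c! · [T^c] Π_j (Σ_l δ_{j,l} T_l)` as a constant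
polynomial, where `L_δ = Σ_l δ_l ∂_l` and `c! = Π_l c_l!`. [folklore] -/
theorem iterDirDeriv_monomial :
    ∀ (L : List (ι → ℕ)) (c : ι →₀ ℕ), c.degree = L.length →
      L.foldl (fun (F : MvPolynomial ι ℚ) (δ : ι → ℕ) => ∑ l, (δ l : ℚ) • pderiv l F)
          (monomial c (1 : ℚ)) =
        C (((c.prod fun _ k => k.factorial : ℕ) : ℚ) *
          coeff c ((L.map fun δ : ι → ℕ => ∑ l, (δ l : ℚ) • (X l : MvPolynomial ι ℚ)).prod)) := by
  intro L
  induction L with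
  | nil =>
    intro c hc
    rw [List.length_nil] at hc
    have hc0 : c = 0 := (Finsupp.degree_eq_zero_iff c).mp hc
    subst hc0
    simp
  | cons δ L ih =>
    intro c hc
    rw [List.length_cons] at hc
    rw [List.foldl_cons, List.map_cons, List.prod_cons]
    -- `L_δ T^c = Σ_l δ_l c_l T^{c - e_l}`
    have hstep : (∑ l, (δ l : ℚ) • pderiv l (monomial c (1 : ℚ))) =
        ∑ l ∈ (univ : Finset ι).filter (fun l => 1 ≤ c l),
          ((δ l : ℚ) * (c l : ℚ)) • monomial (c - Finsupp.single l 1) (1 : ℚ) := by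
      rw [Finset.sum_filter]
      refine Finset.sum_congr rfl fun l _ => ?_
      rw [pderiv_monomial, one_mul]
      by_cases hl : 1 ≤ c l
      · rw [if_pos hl, smul_monomial, smul_monomial, smul_eq_mul, smul_eq_mul, mul_one]
      · have hcl : c l = 0 := by omega
        rw [if_neg hl]
        simp [hcl]
    rw [hstep]
    -- push the remaining operators through the (linear) sum
    have hlin : ∀ (M : List (ι → ℕ)) (s : Finset ι) (g : ι → MvPolynomial ι ℚ) (a : ι → ℚ),
        M.foldl (fun (F : MvPolynomial ι ℚ) (δ : ι → ℕ) => ∑ l, (δ l : ℚ) • pderiv l F)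
          (∑ l ∈ s, a l • g l) =
        ∑ l ∈ s, a l • M.foldl (fun (F : MvPolynomial ι ℚ) (δ : ι → ℕ) => ∑ l, (δ l : ℚ) • pderiv l F)
          (g l) := by
      intro M
      induction M with
      | nil => intro s g a; rfl
      | cons δ' M ihM =>
        intro s g a
        simp only [List.foldl_cons]
        have : (∑ l', (δ' l' : ℚ) • pderiv l' (∑ l ∈ s, a l • g l)) =
            ∑ l ∈ s, a l • ∑ l', (δ' l' : ℚ) • pderiv l' (g l) := by
          simp only [map_sum, Finset.smul_sum]
          rw [Finset.sum_comm]
          refine Finset.sum_congr rfl fun l _ => Finset.sum_congr rfl fun l' _ => ?_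
          simp only [smul_eq_C_mul, pderiv_C_mul]
          ring
        rw [this, ihM]
    rw [hlin]
    -- apply the induction hypothesis to each `T^{c - e_l}`
    have hih : ∀ l ∈ (univ : Finset ι).filter (fun l => 1 ≤ c l),
        L.foldl (fun (F : MvPolynomial ι ℚ) (δ : ι → ℕ) => ∑ l, (δ l : ℚ) • pderiv l F)
          (monomial (c - Finsupp.single l 1) (1 : ℚ)) =
        C ((((c - Finsupp.single l 1).prod fun _ k => k.factorial : ℕ) : ℚ) *
          coeff (c - Finsupp.single l 1)
            ((L.map fun δ : ι → ℕ => ∑ l, (δ l : ℚ) • (X l : MvPolynomial ι ℚ)).prod)) := by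
      intro l hl
      rw [mem_filter] at hl
      apply ih
      have h1 : (c - Finsupp.single l 1).degree + (Finsupp.single l 1).degree = c.degree := by
        rw [← map_add, tsub_add_cancel_of_le (Finsupp.single_le_iff.mpr hl.2)]
      rw [Finsupp.degree_single] at h1
      omega
    rw [Finset.sum_congr rfl fun l hl => by rw [hih l hl]]
    -- collect: `c! = c_l · (c - e_l)!` and the coefficient recursion
    set R : MvPolynomial ι ℚ := (L.map fun δ : ι → ℕ => ∑ l, (δ l : ℚ) • (X l : MvPolynomial ι ℚ)).prod
      with hRdef
    have hR : coeff c ((∑ l, (δ l : ℚ) • (X l : MvPolynomial ι ℚ)) * R) =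
        ∑ l ∈ (univ : Finset ι).filter (fun l => 1 ≤ c l),
          (δ l : ℚ) * coeff (c - Finsupp.single l 1) R := by
      rw [mul_comm]
      exact coeff_mul_linearForm R δ c
    rw [hR, Finset.mul_sum, map_sum]
    refine Finset.sum_congr rfl fun l hl => ?_
    rw [mem_filter] at hl
    have hnat : (c.prod fun _ k => k.factorial) =
        c l * (c - Finsupp.single l 1).prod fun _ k => k.factorial := by
      set c' : ι →₀ ℕ := c - Finsupp.single l 1 with hc'
      have h1 : c' l = c l - 1 := by
        rw [hc', Finsupp.tsub_apply, Finsupp.single_eq_same]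
      have h2 : ∀ i ∈ (univ : Finset ι).erase l, c' i = c i := fun i hi => by
        rw [hc', Finsupp.tsub_apply, Finsupp.single_apply, if_neg (Finset.ne_of_mem_erase hi).symm,
          Nat.sub_zero]
      rw [Finsupp.prod_fintype _ _ (fun _ => Nat.factorial_zero),
        Finsupp.prod_fintype _ _ (fun _ => Nat.factorial_zero)]
      have e1 : (∏ i, (c i).factorial) = (c l).factorial * ∏ i ∈ (univ : Finset ι).erase l,
          (c i).factorial := (Finset.mul_prod_erase _ (fun i => (c i).factorial) (mem_univ l)).symm
      have e2 : (∏ i, (c' i).factorial) = (c' l).factorial * ∏ i ∈ (univ : Finset ι).erase l,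
          (c' i).factorial := (Finset.mul_prod_erase _ (fun i => (c' i).factorial) (mem_univ l)).symm
      have e3 : (∏ i ∈ (univ : Finset ι).erase l, (c' i).factorial) =
          ∏ i ∈ (univ : Finset ι).erase l, (c i).factorial :=
        Finset.prod_congr rfl fun i hi => by rw [h2 i hi]
      rw [e1, e2, h1, e3]
      have hcl : (c l).factorial = c l * (c l - 1).factorial := by
        conv_lhs => rw [show c l = (c l - 1) + 1 by omega, Nat.factorial_succ]
        rw [show c l - 1 + 1 = c l by omega]
      rw [hcl]
      ring
    rw [smul_eq_C_mul, ← map_mul, hnat]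
    push_cast
    congr 1
    ring

end Literature.RingTheory.MvPolynomial

end
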